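import Mathlib
import HarnessLib
import Summits.Ventures.LatticeQCDFlow.Exactness.CircleDegreeOneJacobian

/-!
# The non-compact projection (NCP) and its mixtures: the single-link maps of the U(1) gauge-equivariant flows are certified circle maps with exact Jacobian

HONEST FRAMING: exact (Metropolis-corrected) sampling algorithms for lattice gauge theory;
figures of merit are autocorrelation/cost numbers at stated couplings and volumes; no
continuum-physics claim.

Venture `LatticeQCDFlow` (cell pub-lqcd), topic `Exactness`; FANOUT row 14 (`eng-flowhmc`; the
engine's `u1-flow-trained` member runs these flows inside HMC, twin `ref_u1.U1NCPFlowRef`), for the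
U(1) rung of rows 3 / 4 (`latflow.flows_jax` U(1) coupling layers).  NEW WORK of the cell over
Mathlib (`Real.arctan` calculus) and the tree's `Exactness/CircleDegreeOneJacobian.lean` (row 14:
`hasJacobian_circle_of_degreeOne`, `hasJacobian_coupleFun_of_degreeOne`).  Nothing is cited as a
fact.  Printed counterparts, NAMED ONLY: Kanwar, Albergo, Boyda, Cranmer, Hackett, Racanière,
Rezende, Shanahan, Phys. Rev. Lett. 125 (2020) 121601 (gauge-equivariant flows for U(1); the active
plaquette / link angle is moved by a mixture of non-compact projections `x = tan(θ/2) ↦ e^s x`);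
Rezende et al., ICML 2020 (flows on tori and spheres: NCP, mixtures, degree-one lifts).

## The object

One NCP component with scale `l = e^s > 0` acts on `θ ∈ (−π, π)` by `tan(θ'/2) = l tan(θ/2)`.  Its
LIFT to `ℝ` has the closed form, smooth across `θ = π`,

  `Φ_l(θ) = θ + 2·arctan( (l − 1) sin θ / ((1 + l) + (1 − l) cos θ) )`,
  `Φ_l'(θ) = 2l / ((1 + l²) + (1 − l²) cos θ) = l / (cos²(θ/2) + l² sin²(θ/2)) > 0`,

and `Φ_l(θ + 2π) = Φ_l(θ) + 2π`.  A flow layer moves the active angle by a MIXTURE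
`θ ↦ t + Σ_i w_i (a_i + Φ_{l_i}(θ − a_i))` (weights `w_i ≥ 0`, `Σ w_i = 1`, offsets `a_i`, shift
`t`; all functions of the frozen links through the network).  All statements are about these
explicit expressions (no definitions).

## Content

* `ncp_den_pos`, `ncp_jacDen_pos`, `ncp_deriv_identity`, **`hasDerivAt_ncpLift`**,
  `ncpLift_add_two_pi`, `ncpJac_pos`, `continuous_ncpJac` — the three calculus facts for one
  component; **`hasJacobian_circle_ncp`** — one NCP component is a certified circle map:
  `HasJacobian volume F (ofReal ∘ Φ_l')` on `AddCircle (2π)`.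
* `hasDerivAt_mixture`, `mixture_add_two_pi`, `mixture_deriv_pos` — mixtures of degree-one lifts
  with convex weights are degree-one lifts with positive derivative `Σ_i w_i Φ_i'(θ − a_i)`;
  **`hasJacobian_circle_ncpMixture`** — the Kanwar et al. single-link map is a certified circle
  map with Jacobian `Σ_i w_i Φ_{l_i}'(θ − a_i)` (the density the flow's log-det uses).
* **`hasJacobian_coupleFun_ncpMixture`** — a U(1) COUPLING LAYER whose active links are moved by
  NCP mixtures with weights / scales / offsets / shift measurable in the frozen links is exact on
  `ι → ℝ/2πℤ` with product Haar measure: `HasJacobian (Measure.pi fun _ => volume) (coupleFun p ψ)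
  (ofReal ∘ coupleJac p jac)` (row 31's `Theory2.hasJacobian_coupleFun`, per-link hypothesis
  discharged here).  With `HasJacobian.comp` and `FlowPushforward.flow_reweighting_exact` this is
  the exactness of flow-based sampling with these layers on the U(1) rung, given the exact log-det.

NOT here: plaquette (rather than link) parametrisations of the coupling (a linear change of
variables on the torus, `Theory2` bookkeeping), the softmax / network producing `w, l, a, t`
(only measurability is used), SU(N), autocorrelations.
-/

noncomputable section

namespace Summit.Ventures.LatticeQCDFlow.Exactness

open Real Set Function MeasureTheory Summit.Ventures.LatticeQCDFlow.Theory2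
open scoped NNReal ENNReal

/-! ## One NCP component -/

section NCP

variable {l : ℝ}

/-- The denominator of the lift's correction term is positive: `(1 + l) + (1 − l) cos θ > 0`. -/
theorem ncp_den_pos (hl : 0 < l) (θ : ℝ) : 0 < (1 + l) + (1 - l) * cos θ := by
  have h1 := neg_one_le_cos θ
  have h2 := cos_le_one θ
  by_cases hc : cos θ = -1
  · rw [hc]; linarith
  · have h3 : -1 < cos θ := lt_of_le_of_ne h1 (Ne.symm hc)
    nlinarith [mul_nonneg hl.le (sub_nonneg.2 h2)]

/-- The denominator of the Jacobian factor is positive: `(1 + l²) + (1 − l²) cos θ > 0`. -/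
theorem ncp_jacDen_pos (hl : 0 < l) (θ : ℝ) : 0 < (1 + l ^ 2) + (1 - l ^ 2) * cos θ := by
  have h := ncp_den_pos (pow_pos hl 2) θ
  simpa using h

/-- The algebra behind the derivative of the NCP lift (`S = sin θ`, `C = cos θ`). -/
theorem ncp_deriv_identity (hl : 0 < l) (S C : ℝ) (hSC : S ^ 2 + C ^ 2 = 1) :
    1 + 2 * (1 / (1 + ((l - 1) * S / ((1 + l) + (1 - l) * C)) ^ 2) *
      (((l - 1) * C * ((1 + l) + (1 - l) * C) - (l - 1) * S * ((1 - l) * -S)) /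
        ((1 + l) + (1 - l) * C) ^ 2)) = 2 * l / ((1 + l ^ 2) + (1 - l ^ 2) * C) := by
  set D := (1 + l) + (1 - l) * C with hDdef
  set E := (1 + l ^ 2) + (1 - l ^ 2) * C with hEdef
  set M := (l - 1) * C * D - (l - 1) * S * ((1 - l) * -S) with hMdef
  have hC1 : -1 ≤ C := by nlinarith [sq_nonneg S, sq_nonneg (C + 1)]
  have hC2 : C ≤ 1 := by nlinarith [sq_nonneg S, sq_nonneg (C - 1)]
  have hD : D ≠ 0 := by
    rw [hDdef]
    by_cases hc : C = -1
    · rw [hc]; nlinarith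
    · have h3 : -1 < C := lt_of_le_of_ne hC1 (Ne.symm hc)
      nlinarith [mul_nonneg hl.le (sub_nonneg.2 hC2)]
  have hE : E ≠ 0 := by
    rw [hEdef]
    have hl2 : 0 < l ^ 2 := pow_pos hl 2
    by_cases hc : C = -1
    · rw [hc]; nlinarith
    · have h3 : -1 < C := lt_of_le_of_ne hC1 (Ne.symm hc)
      nlinarith [mul_nonneg hl2.le (sub_nonneg.2 hC2)]
  have hsum : D ^ 2 + ((l - 1) * S) ^ 2 = 2 * E := by
    rw [hDdef, hEdef]; nlinarith [hSC]
  have h1 : 1 + ((l - 1) * S / D) ^ 2 = 2 * E / D ^ 2 := by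
    rw [← hsum]; field_simp
  have h2 : 2 * (1 / (2 * E / D ^ 2) * (M / D ^ 2)) = M / E := by
    rw [one_div_div]; field_simp
  have h3 : E + M = 2 * l := by
    rw [hEdef, hMdef, hDdef]; linear_combination (-(l - 1) ^ 2) * hSC
  rw [h1, h2, one_add_div hE, h3]

/-- **Derivative of the NCP lift**: `d/dθ [θ + 2 arctan((l−1) sin θ / ((1+l) + (1−l) cos θ))]
= 2l / ((1 + l²) + (1 − l²) cos θ)`. -/
theorem hasDerivAt_ncpLift (hl : 0 < l) (θ : ℝ) :
    HasDerivAt (fun θ : ℝ => θ + 2 * arctan ((l - 1) * sin θ / ((1 + l) + (1 - l) * cos θ)))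
      (2 * l / ((1 + l ^ 2) + (1 - l ^ 2) * cos θ)) θ := by
  have hD := (ncp_den_pos hl θ).ne'
  have hu : HasDerivAt (fun θ : ℝ => (l - 1) * sin θ / ((1 + l) + (1 - l) * cos θ))
      (((l - 1) * cos θ * ((1 + l) + (1 - l) * cos θ) - (l - 1) * sin θ * ((1 - l) * -sin θ)) /
        ((1 + l) + (1 - l) * cos θ) ^ 2) θ :=
    ((hasDerivAt_sin θ).const_mul (l - 1)).div
      (((hasDerivAt_cos θ).const_mul (1 - l)).const_add (1 + l)) hD
  exact ((hasDerivAt_id' θ).fun_add (hu.arctan.const_mul 2)).congr_deriv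
    (ncp_deriv_identity hl (sin θ) (cos θ) (sin_sq_add_cos_sq θ))

/-- **Degree one**: `Φ_l(θ + 2π) = Φ_l(θ) + 2π`. -/
theorem ncpLift_add_two_pi (l θ : ℝ) :
    (θ + 2 * π) + 2 * arctan ((l - 1) * sin (θ + 2 * π) / ((1 + l) + (1 - l) * cos (θ + 2 * π))) =
      (θ + 2 * arctan ((l - 1) * sin θ / ((1 + l) + (1 - l) * cos θ))) + 2 * π := by
  rw [sin_add_two_pi, cos_add_two_pi]
  ring

/-- **Positivity**: `Φ_l' > 0`. -/
theorem ncpJac_pos (hl : 0 < l) (θ : ℝ) : 0 < 2 * l / ((1 + l ^ 2) + (1 - l ^ 2) * cos θ) :=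
  div_pos (by positivity) (ncp_jacDen_pos hl θ)

/-- `Φ_l'` is continuous. -/
theorem continuous_ncpJac (hl : 0 < l) :
    Continuous fun θ : ℝ => 2 * l / ((1 + l ^ 2) + (1 - l ^ 2) * cos θ) :=
  continuous_const.div (continuous_const.add (continuous_const.mul continuous_cos))
    fun θ => (ncp_jacDen_pos hl θ).ne'

variable [hT : Fact (0 < 2 * π)]

/-- **One NCP component is a certified circle map**: `HasJacobian volume F (ofReal ∘ Φ_l')`. -/
theorem hasJacobian_circle_ncp (hl : 0 < l) {F : AddCircle (2 * π) → AddCircle (2 * π)}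
    (hF : ∀ θ : ℝ, F θ =
      ((θ + 2 * arctan ((l - 1) * sin θ / ((1 + l) + (1 - l) * cos θ)) : ℝ) : AddCircle (2 * π)))
    {J : AddCircle (2 * π) → ℝ≥0∞}
    (hJ : ∀ θ : ℝ, J θ = ENNReal.ofReal (2 * l / ((1 + l ^ 2) + (1 - l ^ 2) * cos θ))) :
    HasJacobian (volume : Measure (AddCircle (2 * π))) F J :=
  hasJacobian_circle_of_degreeOne (hasDerivAt_ncpLift hl) (continuous_ncpJac hl) (ncpJac_pos hl)
    (ncpLift_add_two_pi l) hF hJ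

end NCP

/-! ## Mixtures of degree-one lifts -/

section Mixture

variable {m : ℕ}

/-- Derivative of a mixture `θ ↦ t + Σ_i w_i (a_i + Φ_i(θ − a_i))`. -/
theorem hasDerivAt_mixture (w a : Fin m → ℝ) (t : ℝ) {Φ Φ' : Fin m → ℝ → ℝ}
    (hderiv : ∀ i θ, HasDerivAt (Φ i) (Φ' i θ) θ) (θ : ℝ) :
    HasDerivAt (fun θ : ℝ => t + ∑ i, w i * (a i + Φ i (θ - a i)))
      (∑ i, w i * Φ' i (θ - a i)) θ := by
  have h : ∀ i ∈ (Finset.univ : Finset (Fin m)),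
      HasDerivAt (fun θ : ℝ => w i * (a i + Φ i (θ - a i))) (w i * Φ' i (θ - a i)) θ := by
    intro i _
    have h1 : HasDerivAt (fun θ : ℝ => Φ i (θ - a i)) (Φ' i (θ - a i)) θ :=
      (hderiv i (θ - a i)).comp_sub_const θ (a i)
    exact (h1.const_add (a i)).const_mul (w i)
  exact (HasDerivAt.fun_sum h).const_add t

/-- Mixtures with weights summing to one are degree-one lifts. -/
theorem mixture_add_two_pi (w a : Fin m → ℝ) (t : ℝ) {Φ : Fin m → ℝ → ℝ}
    (hdeg : ∀ i θ, Φ i (θ + 2 * π) = Φ i θ + 2 * π) (hw1 : ∑ i, w i = 1) (θ : ℝ) :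
    t + ∑ i, w i * (a i + Φ i (θ + 2 * π - a i)) =
      (t + ∑ i, w i * (a i + Φ i (θ - a i))) + 2 * π := by
  have h : ∀ i, Φ i (θ + 2 * π - a i) = Φ i (θ - a i) + 2 * π := fun i => by
    rw [add_sub_right_comm, hdeg]
  simp only [h]
  have e : ∑ i, w i * (a i + (Φ i (θ - a i) + 2 * π)) =
      ∑ i, w i * (a i + Φ i (θ - a i)) + (∑ i, w i) * (2 * π) := by
    rw [Finset.sum_mul, ← Finset.sum_add_distrib]
    exact Finset.sum_congr rfl fun i _ => by ring
  rw [e, hw1]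
  ring

/-- The derivative of a convex mixture of increasing lifts is positive. -/
theorem mixture_deriv_pos (w a : Fin m → ℝ) {Φ' : Fin m → ℝ → ℝ} (hw0 : ∀ i, 0 ≤ w i)
    (hw1 : ∑ i, w i = 1) (hpos : ∀ i θ, 0 < Φ' i θ) (θ : ℝ) :
    0 < ∑ i, w i * Φ' i (θ - a i) := by
  obtain ⟨i, hi⟩ : ∃ i, 0 < w i := by
    by_contra h
    have h0 : ∑ i, w i = 0 :=
      Finset.sum_eq_zero fun i _ => le_antisymm (not_lt.1 fun hi => h ⟨i, hi⟩) (hw0 i)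
    linarith
  exact Finset.sum_pos' (fun j _ => mul_nonneg (hw0 j) (hpos j _).le)
    ⟨i, Finset.mem_univ _, mul_pos hi (hpos i _)⟩

variable [hT : Fact (0 < 2 * π)]

/-- **The Kanwar et al. single-link map is a certified circle map.**  A mixture of NCP components
(scales `l_i > 0`, offsets `a_i`, convex weights `w_i`, shift `t`) lifts to a degree-one `C¹` map
with positive derivative `Σ_i w_i Φ_{l_i}'(θ − a_i)`; any `F`, `J` on `ℝ/2πℤ` with these
representative formulas satisfy `HasJacobian volume F J`. -/
theorem hasJacobian_circle_ncpMixture (w a l : Fin m → ℝ) (t : ℝ) (hw0 : ∀ i, 0 ≤ w i)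
    (hw1 : ∑ i, w i = 1) (hl : ∀ i, 0 < l i) {F : AddCircle (2 * π) → AddCircle (2 * π)}
    (hF : ∀ θ : ℝ, F θ = ((t + ∑ i, w i * (a i + ((θ - a i) +
      2 * arctan ((l i - 1) * sin (θ - a i) / ((1 + l i) + (1 - l i) * cos (θ - a i))))) : ℝ) :
        AddCircle (2 * π)))
    {J : AddCircle (2 * π) → ℝ≥0∞}
    (hJ : ∀ θ : ℝ, J θ = ENNReal.ofReal
      (∑ i, w i * (2 * l i / ((1 + l i ^ 2) + (1 - l i ^ 2) * cos (θ - a i))))) :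
    HasJacobian (volume : Measure (AddCircle (2 * π))) F J :=
  hasJacobian_circle_of_degreeOne
    (Φ := fun θ => t + ∑ i, w i * (a i + ((θ - a i) +
      2 * arctan ((l i - 1) * sin (θ - a i) / ((1 + l i) + (1 - l i) * cos (θ - a i))))))
    (Φ' := fun θ => ∑ i, w i * (2 * l i / ((1 + l i ^ 2) + (1 - l i ^ 2) * cos (θ - a i))))
    (hasDerivAt_mixture w a t fun i θ => hasDerivAt_ncpLift (hl i) θ)
    (continuous_finsetSum _ fun i _ => continuous_const.mul
      ((continuous_ncpJac (hl i)).comp (continuous_id.sub continuous_const)))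
    (mixture_deriv_pos w a hw0 hw1 fun i θ => ncpJac_pos (hl i) θ)
    (mixture_add_two_pi w a t
      (Φ := fun i θ => θ + 2 * arctan ((l i - 1) * sin θ / ((1 + l i) + (1 - l i) * cos θ)))
      (fun i θ => ncpLift_add_two_pi (l i) θ) hw1) hF hJ

end Mixture

/-! ## U(1) coupling layers with NCP mixtures -/

section Coupling

variable [hT : Fact (0 < 2 * π)] {ι : Type*} [Fintype ι] {p : ι → Prop} [DecidablePred p] {m : ℕ}

/-- **U(1) coupling layers with NCP-mixture link maps are exact.**  On `ι → ℝ/2πℤ` with product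
Haar measure and any active predicate `p`: if every active link `b` is moved, given the frozen
links `y`, by an NCP mixture whose weights `w b y` (nonnegative, summing to one), scales
`l b y > 0`, offsets `a b y` and shift `t b y` are measurable functions of `y`, and `ψ`, `jac` are
the circle maps / factors with these representative formulas, then
`HasJacobian (Measure.pi fun _ => volume) (coupleFun p ψ) (ofReal ∘ coupleJac p jac)`. -/
theorem hasJacobian_coupleFun_ncpMixture
    (w a l : {i // p i} → ({i // ¬p i} → AddCircle (2 * π)) → Fin m → ℝ)
    (t : {i // p i} → ({i // ¬p i} → AddCircle (2 * π)) → ℝ)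
    (hw : ∀ b i, Measurable fun y => w b y i) (ha : ∀ b i, Measurable fun y => a b y i)
    (hlm : ∀ b i, Measurable fun y => l b y i) (ht : ∀ b, Measurable (t b))
    (hw0 : ∀ b y i, 0 ≤ w b y i) (hw1 : ∀ b y, ∑ i, w b y i = 1) (hl : ∀ b y i, 0 < l b y i)
    {ψ : {i // p i} → ({i // ¬p i} → AddCircle (2 * π)) → AddCircle (2 * π) → AddCircle (2 * π)}
    (hψ : ∀ b y (θ : ℝ), ψ b y θ = ((t b y + ∑ i, w b y i * (a b y i + ((θ - a b y i) +
      2 * arctan ((l b y i - 1) * sin (θ - a b y i) /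
        ((1 + l b y i) + (1 - l b y i) * cos (θ - a b y i))))) : ℝ) : AddCircle (2 * π)))
    {jac : {i // p i} → ({i // ¬p i} → AddCircle (2 * π)) → AddCircle (2 * π) → ℝ}
    (hjac : ∀ b y (θ : ℝ), jac b y θ =
      ∑ i, w b y i * (2 * l b y i / ((1 + l b y i ^ 2) + (1 - l b y i ^ 2) * cos (θ - a b y i)))) :
    HasJacobian (Measure.pi fun _ : ι => (volume : Measure (AddCircle (2 * π))))
      (coupleFun p ψ) fun U => ENNReal.ofReal (coupleJac p jac U) := by
  refine hasJacobian_coupleFun_of_degreeOne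
    (Φ := fun b y θ => t b y + ∑ i, w b y i * (a b y i + ((θ - a b y i) +
      2 * arctan ((l b y i - 1) * sin (θ - a b y i) /
        ((1 + l b y i) + (1 - l b y i) * cos (θ - a b y i))))))
    (Φ' := fun b y θ => ∑ i, w b y i *
      (2 * l b y i / ((1 + l b y i ^ 2) + (1 - l b y i ^ 2) * cos (θ - a b y i))))
    (fun b y => hasDerivAt_mixture (w b y) (a b y) (t b y) fun i θ => hasDerivAt_ncpLift (hl b y i) θ)
    (fun b y => continuous_finsetSum _ fun i _ => continuous_const.mul
      ((continuous_ncpJac (hl b y i)).comp (continuous_id.sub continuous_const)))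
    (fun b y => mixture_deriv_pos (w b y) (a b y) (hw0 b y) (hw1 b y) fun i θ => ncpJac_pos (hl b y i) θ)
    (fun b y => mixture_add_two_pi (w b y) (a b y) (t b y)
      (Φ := fun i θ => θ + 2 * arctan ((l b y i - 1) * sin θ / ((1 + l b y i) + (1 - l b y i) * cos θ)))
      (fun i θ => ncpLift_add_two_pi (l b y i) θ) (hw1 b y))
    (fun b => ?_) (fun b => ?_) hψ hjac
  · -- joint measurability of the mixture in (θ, frozen links)
    refine ((ht b).comp measurable_snd).add (Finset.measurable_sum _ fun i _ => ?_)
    have hai : Measurable fun w' : ℝ × ({i // ¬p i} → AddCircle (2 * π)) => a b w'.2 i :=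
      (ha b i).comp measurable_snd
    have hli : Measurable fun w' : ℝ × ({i // ¬p i} → AddCircle (2 * π)) => l b w'.2 i :=
      (hlm b i).comp measurable_snd
    have hθa : Measurable fun w' : ℝ × ({i // ¬p i} → AddCircle (2 * π)) => w'.1 - a b w'.2 i :=
      measurable_fst.sub hai
    refine ((hw b i).comp measurable_snd).mul (hai.add (hθa.add (measurable_const.mul ?_)))
    exact measurable_arctan.comp (((hli.sub measurable_const).mul (measurable_sin.comp hθa)).div
      ((measurable_const.add hli).add ((measurable_const.sub hli).mul (measurable_cos.comp hθa))))
  · refine Finset.measurable_sum _ fun i _ => ?_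
    have hai : Measurable fun w' : ℝ × ({i // ¬p i} → AddCircle (2 * π)) => a b w'.2 i :=
      (ha b i).comp measurable_snd
    have hli : Measurable fun w' : ℝ × ({i // ¬p i} → AddCircle (2 * π)) => l b w'.2 i :=
      (hlm b i).comp measurable_snd
    have hθa : Measurable fun w' : ℝ × ({i // ¬p i} → AddCircle (2 * π)) => w'.1 - a b w'.2 i :=
      measurable_fst.sub hai
    refine ((hw b i).comp measurable_snd).mul ((measurable_const.mul hli).div
      ((measurable_const.add (hli.pow_const 2)).add
        ((measurable_const.sub (hli.pow_const 2)).mul (measurable_cos.comp hθa))))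

end Coupling

end Summit.Ventures.LatticeQCDFlow.Exactness
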